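import Mathlib
import Summits.Ventures.HodgeRepro.Tier4.Common.ConcreteAlgebra

/-!
# Tier4/Common/HoloForms — the HOLOMORPHIC concrete forms of `X_{Γ′}` over `D` and their `FormAlgebra`

Blind re-derivation cell `pub-hodge-repro`, Tier 4 (README §9–§10), seat t4-typer-1 (gen 0).  Target tree path
`lean/Summits/Ventures/HodgeRepro/Tier4/Common/HoloForms.lean`.  Imports `Tier4/Common/ConcreteAlgebra.lean`
(typer-1: `concreteForms`, `pairingC`, `wedgeC`, `cH10`, `cH20`).

WHY.  On the bounded measurable invariant forms `d.concreteForms Γ' D` the positivity (T1) `IsPosDefOn` is FALSE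
(typer-2's orbit-indicator instance, S12119: a non-zero invariant `h` supported on a Lebesgue-null `Γ′`-orbit has
`∫_D |h|² = 0`).  The forms of `X_{Γ′}` ARE holomorphic; the form space of record is therefore the submodule of
`concreteForms` of HOLOMORPHIC members (`IsHolo1 ∧ IsHolo2`), on which (T1) is the true statement (typer-2's
`TargetPositivity`, by name).

WHAT IS DEFINED / PROVED.  `d.IsHoloForm Γ' D x` (concrete ∧ holomorphic), the submodule `d.holoForms Γ' D`, its
type `HForm`, `hH10`, `hH20`, **`holoFormAlgebra hD hDm hpos hfin : FormAlgebra (HForm)`** — the same wedge and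
pairing as `ConcreteAlgebra`, the wedge of holomorphic forms being holomorphic (`isHolo2_wedgeField`) — with the
residuals **(T1) `IsPosDefOnHolo`** (positivity on the holomorphic forms) and **(T2)** finite-dimensionality.

Nothing here says anything about the status of the Hodge conjecture for CM abelian varieties, which is NOT proved
(HC_CM is NOT proved by anyone in this repository).
-/

set_option autoImplicit false

noncomputable section

open Matrix MeasureTheory NumberField
open scoped ComplexConjugate ComplexOrder

namespace Summit.Ventures.HodgeRepro.Tier4

open Summit.Ventures.HodgeRepro.Tier4.Common

namespace TargetData

variable {F E : Type} [Field F] [NumberField F] [IsGalois ℚ F] [IsCMField F]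
  [Field E] [NumberField E] [IsGalois ℚ E] [IsCMField E] (d : TargetData F E)

/-- A pair is a holomorphic concrete form: a concrete form of `X_{Γ′}` over `D` whose two components are holomorphic
on the ball. -/
def IsHoloForm (Γ' : Set (Matrix (Fin 3) (Fin 3) E)) (D : Set (Fin 2 → ℂ)) (x : FormPair) : Prop :=
  d.IsConcreteForm Γ' D x ∧ IsHolo1 x.1 ∧ IsHolo2 x.2

/-- **The holomorphic concrete forms of `X_{Γ′}` over `D`** — the form space of record. -/
def holoForms (Γ' : Set (Matrix (Fin 3) (Fin 3) E)) (D : Set (Fin 2 → ℂ)) : Submodule ℂ FormPair where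
  carrier := {x | d.IsHoloForm Γ' D x}
  add_mem' := by
    rintro x y ⟨hx, hx1, hx2⟩ ⟨hy, hy1, hy2⟩
    exact ⟨(d.concreteForms Γ' D).add_mem hx hy, hx1.add hy1, hx2.add hy2⟩
  zero_mem' := ⟨(d.concreteForms Γ' D).zero_mem, differentiableOn_const 0, differentiableOn_const 0⟩
  smul_mem' := by
    rintro c x ⟨hx, hx1, hx2⟩
    exact ⟨(d.concreteForms Γ' D).smul_mem c hx, hx1.const_smul c, hx2.const_smul c⟩

/-- The type of holomorphic concrete forms. -/
abbrev HForm (Γ' : Set (Matrix (Fin 3) (Fin 3) E)) (D : Set (Fin 2 → ℂ)) : Type := ↥(d.holoForms Γ' D)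

/-- Membership in `holoForms`. -/
theorem mem_holoForms (Γ' : Set (Matrix (Fin 3) (Fin 3) E)) (D : Set (Fin 2 → ℂ)) (x : FormPair) :
    x ∈ d.holoForms Γ' D ↔ d.IsHoloForm Γ' D x := Iff.rfl

/-- The wedge of two holomorphic concrete forms is a holomorphic concrete form. -/
theorem IsHoloForm.wedgeC {Γ' : Set (Matrix (Fin 3) (Fin 3) E)} {D : Set (Fin 2 → ℂ)} {x y : FormPair}
    (hx : d.IsHoloForm Γ' D x) (hy : d.IsHoloForm Γ' D y) : d.IsHoloForm Γ' D (Tier4.wedgeC x y) :=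
  ⟨hx.1.wedgeC d hy.1, differentiableOn_const 0, isHolo2_wedgeField hx.2.1 hy.2.1⟩

/-- **(T1) — positive definiteness of the pairing on the HOLOMORPHIC concrete forms** (true: the `L²` positivity
of a non-zero holomorphic invariant form over a fundamental domain; typer-2's `TargetPositivity`). -/
def IsPosDefOnHolo (Γ' : Set (Matrix (Fin 3) (Fin 3) E)) (D : Set (Fin 2 → ℂ)) : Prop :=
  ∀ x : d.HForm Γ' D, x ≠ 0 → 0 < (pairingC D x.1 x.1).re

/-- The `1`-forms among the holomorphic concrete forms. -/
def hH10 (Γ' : Set (Matrix (Fin 3) (Fin 3) E)) (D : Set (Fin 2 → ℂ)) : Submodule ℂ (d.HForm Γ' D) :=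
  LinearMap.ker ((LinearMap.snd ℂ _ _).comp (d.holoForms Γ' D).subtype)

/-- The `2`-forms among the holomorphic concrete forms. -/
def hH20 (Γ' : Set (Matrix (Fin 3) (Fin 3) E)) (D : Set (Fin 2 → ℂ)) : Submodule ℂ (d.HForm Γ' D) :=
  LinearMap.ker ((LinearMap.fst ℂ _ _).comp (d.holoForms Γ' D).subtype)

/-- Membership in `hH10`. -/
theorem mem_hH10 (Γ' : Set (Matrix (Fin 3) (Fin 3) E)) (D : Set (Fin 2 → ℂ)) (x : d.HForm Γ' D) :
    x ∈ d.hH10 Γ' D ↔ x.1.2 = 0 := by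
  simp [hH10]

/-- Membership in `hH20`. -/
theorem mem_hH20 (Γ' : Set (Matrix (Fin 3) (Fin 3) E)) (D : Set (Fin 2 → ℂ)) (x : d.HForm Γ' D) :
    x ∈ d.hH20 Γ' D ↔ x.1.1 = 0 := by
  simp [hH20]

/-- The wedge on holomorphic concrete forms, ℂ-bilinear. -/
def hWedge (Γ' : Set (Matrix (Fin 3) (Fin 3) E)) (D : Set (Fin 2 → ℂ)) :
    d.HForm Γ' D →ₗ[ℂ] d.HForm Γ' D →ₗ[ℂ] d.HForm Γ' D :=
  LinearMap.mk₂ ℂ (fun x y => ⟨Tier4.wedgeC x.1 y.1, x.2.wedgeC d y.2⟩)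
    (fun x x' y => Subtype.ext (wedgeC_add_left x.1 x'.1 y.1))
    (fun c x y => Subtype.ext (wedgeC_smul_left c x.1 y.1))
    (fun x y y' => Subtype.ext (wedgeC_add_right x.1 y.1 y'.1))
    (fun c x y => Subtype.ext (wedgeC_smul_right c x.1 y.1))

/-- The pairing on holomorphic concrete forms, sesquilinear (`D ⊆ 𝔹²` measurable). -/
def hHodge (Γ' : Set (Matrix (Fin 3) (Fin 3) E)) {D : Set (Fin 2 → ℂ)} (hD : D ⊆ ball) (hDm : MeasurableSet D) :
    d.HForm Γ' D →ₗ[ℂ] d.HForm Γ' D →ₗ⋆[ℂ] ℂ :=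
  LinearMap.mk₂'ₛₗ (RingHom.id ℂ) (starRingEnd ℂ) (fun x y => pairingC D x.1 y.1)
    (fun x x' y => pairingC_add_left hD hDm x.2.1.bdd x'.2.1.bdd y.2.1.bdd)
    (fun c x y => pairingC_smul_left D c x.1 y.1)
    (fun x y y' => pairingC_add_right hD hDm x.2.1.bdd y.2.1.bdd y'.2.1.bdd)
    (fun c x y => pairingC_smul_right D c x.1 y.1)

/-- **THE HOLOMORPHIC FORM ALGEBRA**: the seam `FormAlgebra` on the holomorphic concrete forms of `X_{Γ′}` over a
measurable `D ⊆ 𝔹²`, given (T1) positive definiteness and (T2) finite-dimensionality. -/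
def holoFormAlgebra (Γ' : Set (Matrix (Fin 3) (Fin 3) E)) {D : Set (Fin 2 → ℂ)} (hD : D ⊆ ball)
    (hDm : MeasurableSet D) (hpos : d.IsPosDefOnHolo Γ' D) (hfin : FiniteDimensional ℂ (d.HForm Γ' D)) :
    FormAlgebra (d.HForm Γ' D) where
  wedge := d.hWedge Γ' D
  hodge := d.hHodge Γ' hD hDm
  H10 := d.hH10 Γ' D
  H20 := d.hH20 Γ' D
  wedge_mem := fun α β _ _ => by
    rw [mem_hH20]
    rfl
  wedge_self := fun α _ => Subtype.ext (wedgeC_self α.1)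
  hodge_hermitian := fun α β => pairingC_conj D α.1 β.1
  hodge_pos := hpos
  hodge_degree := fun α β hα hβ => by
    rw [mem_hH10] at hα
    rw [mem_hH20] at hβ
    show pairingC D α.1 β.1 = 0
    have hα' : α.1 = (α.1.1, 0) := by rw [← hα]
    have hβ' : β.1 = (0, β.1.2) := by rw [← hβ]
    rw [hα', hβ']
    exact pairingC_degree D α.1.1 β.1.2
  finiteDimensional := hfin

end TargetData

end Summit.Ventures.HodgeRepro.Tier4
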